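import Literature.Computability.QuantumComplexity.PermanentSearchRandom
import Literature.Computability.Complexity.OracleReplay
import HarnessLib

/-!
# Replaying the search of AA13 Thm. 4.3 against a transcript: a loop-shaped model of `toStep`

Aaronson–Arkhipov, *The computational complexity of linear optics*, Theory of Computing 9 (2013),
proof of Thm. 4.3 (pp. 176–177): the permanent of a `0/1` matrix is found by a recursion on the
dimension (a pivot row, the permanent of its minor) followed by a binary search. The tree's
`PerSearch.perLevel mk g n X` (`PermanentSearch.lean`) is that procedure as an oracle computation
tree, and the named fact `PerSearch.randSearchAlg_isPolyTime` (`PermanentSearchRandom.lean`) asks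
for a polynomial-time machine computing its *transcript step function* `toStep` — the replay of the
tree against the list of answers received so far (`OracleReplay.lean`: `OracleComp.replay`,
`replay_bind`). A machine cannot follow the recursion of `perLevel` literally; it runs two loops.
This file is the mathematical half of that machine: the replay outcome of `perLevel` written as
two answer-consuming loops, with no reference to machines or codes.

* Generic replay laws used by the machine: `replay_relabel` (relabelling the queries),
  `replay_firstM_cons`, `replay_iterM_succ`, `replay_forEach_askMap` (a block of post-processed
  queries consumes `|l|` answers or is stuck at query number `|as|`).
* One level of the recursion split into its **pre-phase** `levelPre` (value of `X`; pivot scan)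
  and its **post-phase** `levelPost` (the rounds of `searchRound`, the rounding), and
  `replay_perLevel_succ`: the replay of `perLevel (n+1) X` is the pre-phase, then the replay of the
  recursive call on the minor, then the post-phase.
* The pivot scan as a counted loop (`pivScan`, `replay_firstM_pivot`), one search round
  (`replay_searchRound`: a round consumes exactly `3g + 1` answers — or none when the value is
  `0` — or is stuck at the grid query number `|as|`), the rounds (`replay_iterM_succ`).
* **The two-loop model**: `descend` walks down the dimensions collecting one `Frame` (matrix,
  pivot, first value) per level until the bottom, an early exit (value `0`) or a missing answer;
  `ascend` then runs the post-phases of the collected frames innermost first; `descend_eq`: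
  `descend n X fs as` is the replay of `perLevel n X` followed by `ascend` on the frames `fs`, so
  `replay_perLevel_eq_descend : replay (perLevel mk g n X) as = descend mk g n X [] as`.

## References

* S. Aaronson, A. Arkhipov, *The computational complexity of linear optics*, Theory of Computing 9
  (2013) 143–252, proof of Thm. 4.3 (pp. 176–177).
* S. Arora, B. Barak, *Computational Complexity: A Modern Approach*, CUP 2009, §3.4 (the
  configuration of an oracle machine after `i` answers is determined by the input and the answers).
-/

namespace Literature.Computability.QuantumComplexity

open _root_.Computability Complexity Complexity.OracleComp Matrix

namespace PerSearch

/-! ### Generic replay laws -/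

section Generic

variable {α β σ : Type}

/-- **Replay of a relabelled computation**: the same answers are consumed, the pending query is
relabelled. [cite: AroraBarak2009, §3.4] -/
theorem replay_relabel (φ : List Bool → List Bool) :
    ∀ (c : OracleComp β) (as : List (List Bool)),
      replay (relabel φ c) as = (replay c as).map φ id
  | OracleComp.pure b, as => by simp
  | OracleComp.query q k, [] => by simp
  | OracleComp.query q k, a :: as => by
    rw [relabel_query, replay_query_cons, replay_query_cons]
    exact replay_relabel φ (k a) as

/-- Replay of `firstM` on a nonempty list: replay the head test; a hit ends the scan, a miss
continues with the tail on the leftover answers. [folklore] -/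
theorem replay_firstM_cons (f : α → OracleComp (Option β)) (a : α) (l : List α) (as : List (List Bool)) :
    replay (firstM f (a :: l)) as =
      match replay (f a) as with
      | Sum.inl q => Sum.inl q
      | Sum.inr (some b, as') => Sum.inr (some b, as')
      | Sum.inr (none, as') => replay (firstM f l) as' := by
  rw [firstM, replay_bind]
  rcases replay (f a) as with q | ⟨_ | b, as'⟩ <;> rfl

/-- Replay of `firstM` on the empty list. [folklore] -/
@[simp] theorem replay_firstM_nil (f : α → OracleComp (Option β)) (as : List (List Bool)) :
    replay (firstM f ([] : List α)) as = Sum.inr (none, as) := by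
  rw [firstM, replay_pure]

/-- Replay of a bounded loop: one round, then the remaining rounds on the leftover answers. [folklore] -/
theorem replay_iterM_succ (f : σ → OracleComp σ) (k : ℕ) (s : σ) (as : List (List Bool)) :
    replay (iterM f (k + 1) s) as =
      match replay (f s) as with
      | Sum.inl q => Sum.inl q
      | Sum.inr (s', as') => replay (iterM f k s') as' := by
  rw [iterM, replay_bind]
  rcases replay (f s) as with q | ⟨s', as'⟩ <;> rfl

/-- Replay of zero rounds. [folklore] -/
@[simp] theorem replay_iterM_zero (f : σ → OracleComp σ) (s : σ) (as : List (List Bool)) :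
    replay (iterM f 0 s) as = Sum.inr (s, as) := by
  rw [iterM, replay_pure]

/-- **A block of post-processed queries**: `forEach (fun i => ask (q i) >>= fun a => pure (h i a)) l`
with at least `|l|` answers returns the processed first `|l|` answers and leaves the rest; with
fewer it is stuck at query number `|as|`. [folklore] -/
theorem replay_forEach_askMap (q : α → List Bool) (h : α → List Bool → β) :
    ∀ (l : List α) (as : List (List Bool)),
      replay (forEach (fun i => OracleComp.bind (ask (q i)) fun a => OracleComp.pure (h i a)) l) as =
        if hl : l.length ≤ as.length then
          Sum.inr (List.zipWith h l (as.take l.length), as.drop l.length)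
        else Sum.inl (q (l[as.length]'(not_le.1 hl)))
  | [], as => by simp [forEach]
  | i :: l, [] => by
    rw [dif_neg (by simp)]
    simp [forEach, replay_bind, ask]
  | i :: l, a :: as => by
    rw [forEach, replay_bind, replay_bind, replay_ask_cons]
    dsimp only
    rw [replay_pure]
    dsimp only
    rw [replay_bind, replay_forEach_askMap q h l as]
    by_cases hl : l.length ≤ as.length
    · rw [dif_pos hl]
      dsimp only
      rw [replay_pure, dif_pos (by simpa using hl)]
      simp
    · rw [dif_neg hl, dif_neg (by simpa using hl)]
      simp

end Generic

/-! ### Relabelling the queries of the search -/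

section Relabel

variable {α β σ : Type} (φ : List Bool → List Bool)

/-- `relabel` commutes with `forEach`. [folklore] -/
@[simp] theorem relabel_forEach (f : α → OracleComp β) (l : List α) :
    relabel φ (forEach f l) = forEach (fun a => relabel φ (f a)) l := by
  induction l with
  | nil => rfl
  | cons a l ih => simp only [forEach, relabel_bind, ih, relabel_pure]

/-- `relabel` commutes with `iterM`. [folklore] -/
@[simp] theorem relabel_iterM (f : σ → OracleComp σ) (k : ℕ) (s : σ) :
    relabel φ (iterM f k s) = iterM (fun s => relabel φ (f s)) k s := by
  induction k generalizing s with
  | zero => rfl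
  | succ k ih => simp only [iterM, relabel_bind, ih]

/-- `relabel` commutes with `firstM`. [folklore] -/
@[simp] theorem relabel_firstM (f : α → OracleComp (Option β)) (l : List α) :
    relabel φ (firstM f l) = firstM (fun a => relabel φ (f a)) l := by
  induction l with
  | nil => rfl
  | cons a l ih =>
    simp only [firstM, relabel_bind]
    congr 1
    funext r
    cases r with
    | none => exact ih
    | some b => rfl

/-- `relabel` of a conditional. [folklore] -/
theorem relabel_ite (P : Prop) [Decidable P] (a b : OracleComp β) :
    relabel φ (if P then a else b) = if P then relabel φ a else relabel φ b := by
  split_ifs <;> rfl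

variable (mk : Maker)

/-- Relabelling a value query changes the maker. [folklore] -/
@[simp] theorem relabel_askV (i : Site) {n : ℕ} (X : Matrix (Fin n) (Fin n) ℤ) :
    relabel φ (askV mk i X) = askV (fun s M => φ (mk s M)) i X := rfl

/-- Relabelling a minor query changes the maker. [folklore] -/
@[simp] theorem relabel_askMinor (i : Site) {n : ℕ} (Y : Matrix (Fin n) (Fin n) ℤ) :
    relabel φ (askMinor mk i Y) = askMinor (fun s M => φ (mk s M)) i Y := by
  cases n <;> rfl

/-- Relabelling a search round changes the maker. [folklore] -/
@[simp] theorem relabel_searchRound (g lvl : ℕ) {n : ℕ} (X : Matrix (Fin (n + 1)) (Fin (n + 1)) ℤ) (PY : ℕ)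
    (st : ℕ × ℚ × ℕ) :
    relabel φ (searchRound mk g lvl X PY st) = searchRound (fun s M => φ (mk s M)) g lvl X PY st := by
  unfold searchRound
  rw [relabel_ite]
  simp only [relabel_pure, relabel_bind, relabel_forEach, relabel_askV]

/-- **Relabelling the search changes the maker**: `relabel φ (perLevel mk g n X)` is the search with
the maker `φ ∘ mk` (the queries of `perLevel` are made by `mk` only). [cite: AaronsonArkhipovToC2013, proof of Thm. 1.1 (p. 178)] -/
theorem relabel_perLevel (g : ℕ) : ∀ (n : ℕ) (X : Matrix (Fin n) (Fin n) ℤ),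
    relabel φ (perLevel mk g n X) = perLevel (fun s M => φ (mk s M)) g n X
  | 0, X => rfl
  | n + 1, X => by
    rw [perLevel, perLevel, relabel_bind, relabel_askV]
    congr 1
    funext v0
    rw [relabel_ite, relabel_pure]
    congr 1
    rw [relabel_bind, relabel_firstM]
    congr 1
    · congr 1
      funext p
      rw [relabel_ite, relabel_pure, relabel_bind, relabel_askMinor]
      rfl
    · funext piv
      cases piv with
      | none => rfl
      | some p =>
        dsimp only
        rw [relabel_bind, relabel_perLevel g n]
        congr 1
        funext PY
        rw [relabel_ite, relabel_pure, relabel_bind, relabel_iterM]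
        simp only [relabel_searchRound, relabel_pure]

end Relabel

/-! ### One level of the recursion: pre-phase and post-phase -/

section Level

variable (mk : Maker) (g : ℕ)

/-- The test of the pivot candidate `p` (AA13 p. 176: a row `p` with `x_{p1} = 1` whose minor has
nonzero permanent): no query if `X p 0 ≠ 1`; otherwise the value of the minor is asked (no query
for the empty minor) and `p` is kept iff it is nonzero. [cite: AaronsonArkhipovToC2013, proof of Thm. 4.3 (p. 176)] -/
def pivotTest {n : ℕ} (X : Matrix (Fin (n + 1)) (Fin (n + 1)) ℤ) (p : Fin (n + 1)) :
    OracleComp (Option (Fin (n + 1))) :=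
  if X p 0 ≠ 1 then OracleComp.pure none else
    OracleComp.bind (askMinor mk (n + 1, 1, p, 0) (X.submatrix p.succAbove Fin.succ)) fun b =>
      OracleComp.pure (if b = 0 then none else some p)

/-- **The pre-phase of a level**: ask the value of `X`; if it is `0` exit (`none`), else scan for a
pivot `p` and return it with the value (`none` if there is no pivot). [cite: AaronsonArkhipovToC2013, proof of Thm. 4.3 (p. 176)] -/
def levelPre {n : ℕ} (X : Matrix (Fin (n + 1)) (Fin (n + 1)) ℤ) : OracleComp (Option (Fin (n + 1) × ℕ)) :=
  OracleComp.bind (askV mk (n + 1, 0, 0, 0) X) fun v0 =>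
    if v0 = 0 then OracleComp.pure none else
      OracleComp.bind (firstM (pivotTest mk X) (List.finRange (n + 1))) fun piv =>
        OracleComp.pure (piv.map fun p => (p, v0))

/-- The matrix with the pivot row moved to the top (`X'` of AA13 p. 176, "by permuting the rows"). [cite: AaronsonArkhipovToC2013, proof of Thm. 4.3 (p. 176)] -/
def topMatrix {n : ℕ} (X : Matrix (Fin (n + 1)) (Fin (n + 1)) ℤ) (p : Fin (n + 1)) :
    Matrix (Fin (n + 1)) (Fin (n + 1)) ℤ :=
  X.submatrix (Fin.cons p p.succAbove) id

/-- The minor on which the recursion continues: row `p` and column `0` deleted (`Y` of AA13). [cite: AaronsonArkhipovToC2013, proof of Thm. 4.3 (p. 176)] -/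
def minorOf {n : ℕ} (X : Matrix (Fin (n + 1)) (Fin (n + 1)) ℤ) (p : Fin (n + 1)) : Matrix (Fin n) (Fin n) ℤ :=
  (topMatrix X p).submatrix Fin.succ Fin.succ

/-- The recursion's minor is `X` with row `p` and column `0` deleted (the rows keep their order). [folklore] -/
theorem minorOf_eq {n : ℕ} (X : Matrix (Fin (n + 1)) (Fin (n + 1)) ℤ) (p : Fin (n + 1)) :
    minorOf X p = X.submatrix p.succAbove Fin.succ := by
  ext i j
  simp [topMatrix, minorOf]

/-- **The post-phase of a level**, given the permanent `PY` of the minor: the clamp (`PY = 0` or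
`PY > n!` gives `0`), the `rounds g n` rounds of `searchRound` from `(0, 0, v0)`, and the rounding
`round (r · PY)`. [cite: AaronsonArkhipovToC2013, proof of Thm. 4.3 (pp. 176–177)] -/
def levelPost {n : ℕ} (X : Matrix (Fin (n + 1)) (Fin (n + 1)) ℤ) (p : Fin (n + 1)) (v0 PY : ℕ) : OracleComp ℕ :=
  if PY = 0 ∨ n.factorial < PY then OracleComp.pure 0 else
    OracleComp.bind (iterM (searchRound mk g (n + 1) (topMatrix X p) PY) (rounds g n) (0, 0, v0)) fun st =>
      OracleComp.pure (round (st.2.1 * PY)).toNat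

/-- **One level of the recursion, re-associated**: `perLevel (n+1) X` is the value query, the exit
test, the pivot scan, and on a pivot the recursive call on the minor followed by the post-phase
(definitional unfolding of `perLevel`). [cite: AaronsonArkhipovToC2013, proof of Thm. 4.3 (pp. 176–177)] -/
theorem perLevel_succ {n : ℕ} (X : Matrix (Fin (n + 1)) (Fin (n + 1)) ℤ) :
    perLevel mk g (n + 1) X =
      OracleComp.bind (askV mk (n + 1, 0, 0, 0) X) fun v0 =>
        if v0 = 0 then OracleComp.pure 0 else
          OracleComp.bind (firstM (pivotTest mk X) (List.finRange (n + 1))) fun piv =>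
            match piv with
            | none => OracleComp.pure 0
            | some p => OracleComp.bind (perLevel mk g n (minorOf X p)) fun PY => levelPost mk g X p v0 PY :=
  rfl

/-- **Replay of one level**: the replay of `perLevel (n+1) X` is the pre-phase; on an exit the
value `0` with no further query; on a pivot the replay of the recursive call on the minor followed
by the post-phase. [cite: AaronsonArkhipovToC2013, proof of Thm. 4.3 (pp. 176–177)] -/
theorem replay_perLevel_succ {n : ℕ} (X : Matrix (Fin (n + 1)) (Fin (n + 1)) ℤ) (as : List (List Bool)) :
    replay (perLevel mk g (n + 1) X) as =
      match replay (levelPre mk X) as with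
      | Sum.inl q => Sum.inl q
      | Sum.inr (none, as') => Sum.inr (0, as')
      | Sum.inr (some (p, v0), as') =>
        match replay (perLevel mk g n (minorOf X p)) as' with
        | Sum.inl q => Sum.inl q
        | Sum.inr (PY, as'') => replay (levelPost mk g X p v0 PY) as'' := by
  rw [perLevel_succ, levelPre, replay_bind, replay_bind]
  rcases replay (askV mk (n + 1, 0, 0, 0) X) as with q | ⟨v0, as₁⟩
  · rfl
  · dsimp only
    by_cases hv : v0 = 0
    · rw [if_pos hv, if_pos hv, replay_pure, replay_pure]
    · rw [if_neg hv, if_neg hv, replay_bind, replay_bind]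
      rcases replay (firstM (pivotTest mk X) (List.finRange (n + 1))) as₁ with q | ⟨_ | p, as₂⟩
      · rfl
      · dsimp only
        rw [replay_pure, replay_pure]
        simp
      · dsimp only
        rw [replay_pure, replay_bind]
        simp only [Option.map_some]
        rcases replay (perLevel mk g n (minorOf X p)) as₂ with q | ⟨PY, as₃⟩ <;> rfl

/-! ### The pre-phase as a counted loop -/

/-- **The pivot scan from candidate `j` on** (the replay of `firstM (pivotTest X)` over the
candidates `j, j+1, …, n`): a candidate with `X j 0 ≠ 1` costs no answer; for `n = 0` the empty
minor is not asked and the candidate is taken; otherwise one answer is consumed (`0`: next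
candidate; nonzero: pivot found), and with no answer left the minor's query is pending. [cite: AaronsonArkhipovToC2013, proof of Thm. 4.3 (p. 176)] -/
def pivScan {n : ℕ} (X : Matrix (Fin (n + 1)) (Fin (n + 1)) ℤ) :
    ℕ → ℕ → List (List Bool) → List Bool ⊕ (Option (Fin (n + 1)) × List (List Bool))
  | 0, _, as => Sum.inr (none, as)
  | fuel + 1, j, as =>
    if hj : j < n + 1 then
      if X ⟨j, hj⟩ 0 ≠ 1 then pivScan X fuel (j + 1) as
      else if n = 0 then Sum.inr (some ⟨j, hj⟩, as)
      else match as with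
        | [] => Sum.inl (mk (n + 1, 1, j, 0) ⟨n, fun a b => X.submatrix (Fin.succAbove ⟨j, hj⟩) Fin.succ a b⟩)
        | a :: as' => if decodeNat a = 0 then pivScan X fuel (j + 1) as' else Sum.inr (some ⟨j, hj⟩, as')
    else Sum.inr (none, as)

/-- Replay of one pivot test. [folklore] -/
theorem replay_pivotTest {n : ℕ} (X : Matrix (Fin (n + 1)) (Fin (n + 1)) ℤ) (p : Fin (n + 1))
    (as : List (List Bool)) :
    replay (pivotTest mk X p) as =
      if X p 0 ≠ 1 then Sum.inr (none, as)
      else if n = 0 then Sum.inr (some p, as)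
      else match as with
        | [] => Sum.inl (mk (n + 1, 1, p, 0) ⟨n, fun a b => X.submatrix p.succAbove Fin.succ a b⟩)
        | a :: as' => if decodeNat a = 0 then Sum.inr (none, as') else Sum.inr (some p, as') := by
  unfold pivotTest
  by_cases h1 : X p 0 ≠ 1
  · rw [if_pos h1, if_pos h1, replay_pure]
  · rw [if_neg h1, if_neg h1, replay_bind]
    cases n with
    | zero =>
      rw [if_pos rfl]
      simp [askMinor]
    | succ m =>
      rw [if_neg (Nat.succ_ne_zero m)]
      cases as with
      | nil => simp [askMinor, askV, ask, replay_bind]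
      | cons a as' =>
        simp only [askMinor, askV, ask]
        rw [replay_bind]
        simp only [replay_query_cons, replay_pure]
        by_cases ha : decodeNat a = 0 <;> simp [ha]

/-- The scan over the candidate list `[j, j+1, …, n]` is `pivScan` with enough fuel. [folklore] -/
theorem replay_firstM_pivot_aux {n : ℕ} (X : Matrix (Fin (n + 1)) (Fin (n + 1)) ℤ) :
    ∀ (fuel j : ℕ) (as : List (List Bool)), n + 1 - j ≤ fuel →
      replay (firstM (pivotTest mk X) ((List.finRange (n + 1)).drop j)) as = pivScan mk X fuel j as
  | 0, j, as, h => by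
    have : (List.finRange (n + 1)).drop j = [] := List.drop_eq_nil_of_le (by simp; omega)
    rw [this, replay_firstM_nil]; rfl
  | fuel + 1, j, as, h => by
    by_cases hj : j < n + 1
    · have hdrop : (List.finRange (n + 1)).drop j = ⟨j, hj⟩ :: (List.finRange (n + 1)).drop (j + 1) := by
        rw [List.drop_eq_getElem_cons (by simpa using hj)]
        congr 1
        exact Fin.ext (by simp)
      rw [hdrop, replay_firstM_cons, replay_pivotTest, pivScan, dif_pos hj]
      by_cases h1 : X ⟨j, hj⟩ 0 ≠ 1
      · rw [if_pos h1, if_pos h1]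
        exact replay_firstM_pivot_aux X fuel (j + 1) as (by omega)
      · rw [if_neg h1, if_neg h1]
        by_cases hn : n = 0
        · rw [if_pos hn, if_pos hn]
        · rw [if_neg hn, if_neg hn]
          cases as with
          | nil => rfl
          | cons a as' =>
            dsimp only
            by_cases ha : decodeNat a = 0
            · rw [if_pos ha, if_pos ha]
              exact replay_firstM_pivot_aux X fuel (j + 1) as' (by omega)
            · rw [if_neg ha, if_neg ha]
    · have : (List.finRange (n + 1)).drop j = [] := List.drop_eq_nil_of_le (by simp; omega)
      rw [this, replay_firstM_nil, pivScan, dif_neg hj]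

/-- **The pivot scan of the pre-phase is the loop `pivScan`** with `n + 1` rounds of fuel from
candidate `0`. [cite: AaronsonArkhipovToC2013, proof of Thm. 4.3 (p. 176)] -/
theorem replay_firstM_pivot {n : ℕ} (X : Matrix (Fin (n + 1)) (Fin (n + 1)) ℤ) (as : List (List Bool)) :
    replay (firstM (pivotTest mk X) (List.finRange (n + 1))) as = pivScan mk X (n + 1) 0 as := by
  have h := replay_firstM_pivot_aux mk X (n + 1) 0 as (by omega)
  rwa [List.drop_zero] at h

/-- **Replay of the pre-phase**: no answer — the value of `X` is pending; first answer `0` — exit;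
otherwise the pivot scan on the remaining answers, the pivot paired with the value. [cite: AaronsonArkhipovToC2013, proof of Thm. 4.3 (p. 176)] -/
theorem replay_levelPre {n : ℕ} (X : Matrix (Fin (n + 1)) (Fin (n + 1)) ℤ) (as : List (List Bool)) :
    replay (levelPre mk X) as =
      match as with
      | [] => Sum.inl (mk (n + 1, 0, 0, 0) ⟨n + 1, fun a b => X a b⟩)
      | a :: as' =>
        if decodeNat a = 0 then Sum.inr (none, as')
        else (pivScan mk X (n + 1) 0 as').map id fun r => (r.1.map fun p => (p, decodeNat a), r.2) := by
  unfold levelPre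
  cases as with
  | nil => simp [askV, ask, replay_bind]
  | cons a as' =>
    simp only [askV, ask]
    rw [replay_bind, replay_bind]
    simp only [replay_query_cons, replay_pure]
    by_cases ha : decodeNat a = 0
    · rw [if_pos ha, if_pos ha, replay_pure]
    · rw [if_neg ha, if_neg ha, replay_bind, replay_firstM_pivot]
      rcases pivScan mk X (n + 1) 0 as' with q | ⟨piv, as''⟩
      · rfl
      · simp

/-! ### One search round -/

/-- The `i`-th grid point of the round from the state `(t, r, v)` at level `n + 1` with minor
permanent `PY` (AA13 (4.9)–(4.10): the points `s(i)` of `[r − β', r + β']`). [cite: AaronsonArkhipovToC2013, proof of Thm. 4.3, eqs. (4.9)–(4.10) (p. 177)] -/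
def roundPt (n PY : ℕ) (st : ℕ × ℚ × ℕ) (i : ℕ) : ℚ :=
  gridPt st.2.1 ((halfK g n st.2.2 st.2.1.den : ℕ) / ((st.2.1.den : ℚ) * PY)) (3 * g) i

/-- **Replay of one search round** from `(t, r, v)`: if `v = 0` the state is kept (round counter
bumped) at no cost; otherwise, with at least `3g + 1` answers the `3g + 1` grid points are paired
with the received values, the arg-min is the new state and `3g + 1` answers are consumed; with
fewer answers the grid query number `|as|` is pending. [cite: AaronsonArkhipovToC2013, proof of Thm. 4.3, eqs. (4.9)–(4.15) (p. 177)] -/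
theorem replay_searchRound (lvl : ℕ) {n : ℕ} (X : Matrix (Fin (n + 1)) (Fin (n + 1)) ℤ) (PY : ℕ)
    (st : ℕ × ℚ × ℕ) (as : List (List Bool)) :
    replay (searchRound mk g lvl X PY st) as =
      if st.2.2 = 0 then Sum.inr ((st.1 + 1, st.2.1, st.2.2), as)
      else if 3 * g + 1 ≤ as.length then
        Sum.inr ((st.1 + 1,
          (argminBy keyW ((0 : ℚ), 0) (List.zipWith (fun i a => (roundPt g n PY st i, decodeNat a))
            (List.range (3 * g + 1)) (as.take (3 * g + 1)))).1,
          (argminBy keyW ((0 : ℚ), 0) (List.zipWith (fun i a => (roundPt g n PY st i, decodeNat a))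
            (List.range (3 * g + 1)) (as.take (3 * g + 1)))).2), as.drop (3 * g + 1))
      else Sum.inl (mk (lvl, 2, st.1, as.length) ⟨n + 1, fun a b => scaledMatrix X (roundPt g n PY st as.length) a b⟩) := by
  unfold searchRound
  by_cases hv : st.2.2 = 0
  · rw [if_pos hv, if_pos hv, replay_pure]
  · rw [if_neg hv, if_neg hv, replay_bind]
    have key := replay_forEach_askMap
      (fun i : ℕ => mk (lvl, 2, st.1, i) ⟨n + 1, fun a b => scaledMatrix X (roundPt g n PY st i) a b⟩)
      (fun i a => (roundPt g n PY st i, decodeNat a)) (List.range (3 * g + 1)) as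
    simp only [askV, roundPt] at key ⊢
    have e : (forEach (fun i => OracleComp.bind
        (OracleComp.bind (ask (mk (lvl, 2, st.1, i) ⟨n + 1, fun a b =>
          scaledMatrix X (gridPt st.2.1 (↑(halfK g n st.2.2 st.2.1.den) / (↑st.2.1.den * ↑PY)) (3 * g) i) a b⟩))
          fun a => OracleComp.pure (decodeNat a))
        fun w => OracleComp.pure (gridPt st.2.1 (↑(halfK g n st.2.2 st.2.1.den) / (↑st.2.1.den * ↑PY)) (3 * g) i, w))
        (List.range (3 * g + 1))) =
        forEach (fun i => OracleComp.bind
          (ask (mk (lvl, 2, st.1, i) ⟨n + 1, fun a b =>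
            scaledMatrix X (gridPt st.2.1 (↑(halfK g n st.2.2 st.2.1.den) / (↑st.2.1.den * ↑PY)) (3 * g) i) a b⟩))
          fun a => OracleComp.pure (gridPt st.2.1 (↑(halfK g n st.2.2 st.2.1.den) / (↑st.2.1.den * ↑PY)) (3 * g) i,
            decodeNat a)) (List.range (3 * g + 1)) := by
      congr 1
    rw [e, key]
    by_cases h : 3 * g + 1 ≤ as.length
    · have h' : (List.range (3 * g + 1)).length ≤ as.length := by simpa using h
      rw [dif_pos h', if_pos h]
      dsimp only
      rw [replay_pure]
      simp
    · have h' : ¬ (List.range (3 * g + 1)).length ≤ as.length := by simpa using h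
      rw [dif_neg h', if_neg h]
      simp

/-- **Replay of the post-phase**: the clamp gives `0` at no cost; otherwise the rounds are
replayed (`replay_iterM_succ`, `replay_searchRound`) and a finished search is rounded. [cite: AaronsonArkhipovToC2013, proof of Thm. 4.3, eqs. (4.16)–(4.19) (p. 177)] -/
theorem replay_levelPost {n : ℕ} (X : Matrix (Fin (n + 1)) (Fin (n + 1)) ℤ) (p : Fin (n + 1)) (v0 PY : ℕ)
    (as : List (List Bool)) :
    replay (levelPost mk g X p v0 PY) as =
      if PY = 0 ∨ n.factorial < PY then Sum.inr (0, as)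
      else match replay (iterM (searchRound mk g (n + 1) (topMatrix X p) PY) (rounds g n) (0, 0, v0)) as with
        | Sum.inl q => Sum.inl q
        | Sum.inr (st, as') => Sum.inr ((round (st.2.1 * PY)).toNat, as') := by
  unfold levelPost
  by_cases h : PY = 0 ∨ n.factorial < PY
  · rw [if_pos h, if_pos h, replay_pure]
  · rw [if_neg h, if_neg h, replay_bind]
    rcases replay (iterM (searchRound mk g (n + 1) (topMatrix X p) PY) (rounds g n) (0, 0, v0)) as with q | ⟨st, as'⟩
    · rfl
    · dsimp only
      rw [replay_pure]

/-! ### The two-loop model -/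

/-- **A frame of the recursion**: the matrix of a level (of dimension `n + 1`), its pivot and the
value received for it — what the post-phase of that level needs besides the permanent of the minor. [cite: AaronsonArkhipovToC2013, proof of Thm. 4.3 (pp. 176–177)] -/
structure Frame where
  /-- the dimension of the minor (the level is `n + 1`) -/
  n : ℕ
  /-- the matrix of the level -/
  X : Matrix (Fin (n + 1)) (Fin (n + 1)) ℤ
  /-- the pivot row -/
  p : Fin (n + 1)
  /-- the value received for `X` -/
  v0 : ℕ

/-- **The ascending loop**: run the post-phases of the frames, innermost first, threading the
permanent found so far (`PY`) and the answers; stop at a pending query. [cite: AaronsonArkhipovToC2013, proof of Thm. 4.3 (pp. 176–177)] -/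
def ascend : ℕ → List Frame → List (List Bool) → List Bool ⊕ (ℕ × List (List Bool))
  | PY, [], as => Sum.inr (PY, as)
  | PY, f :: fs, as =>
    match replay (levelPost mk g f.X f.p f.v0 PY) as with
    | Sum.inl q => Sum.inl q
    | Sum.inr (v, as') => ascend v fs as'

/-- **The descending loop**: run the pre-phases level by level, pushing a frame per level; at
dimension `0` the value is `1`, on an exit it is `0`, and either value is handed to `ascend` on the
frames collected; stop at a pending query. [cite: AaronsonArkhipovToC2013, proof of Thm. 4.3 (pp. 176–177)] -/
def descend : (n : ℕ) → Matrix (Fin n) (Fin n) ℤ → List Frame → List (List Bool) →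
    List Bool ⊕ (ℕ × List (List Bool))
  | 0, _, fs, as => ascend mk g 1 fs as
  | n + 1, X, fs, as =>
    match replay (levelPre mk X) as with
    | Sum.inl q => Sum.inl q
    | Sum.inr (none, as') => ascend mk g 0 fs as'
    | Sum.inr (some (p, v0), as') => descend n (minorOf X p) (⟨n, X, p, v0⟩ :: fs) as'

/-- **The two loops replay the recursion**: descending from `(n, X)` with pending frames `fs` is
the replay of `perLevel n X` followed by the ascent through `fs`. [cite: AaronsonArkhipovToC2013, proof of Thm. 4.3 (pp. 176–177)] -/
theorem descend_eq : ∀ (n : ℕ) (X : Matrix (Fin n) (Fin n) ℤ) (fs : List Frame) (as : List (List Bool)),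
    descend mk g n X fs as =
      match replay (perLevel mk g n X) as with
      | Sum.inl q => Sum.inl q
      | Sum.inr (v, as') => ascend mk g v fs as'
  | 0, X, fs, as => by simp only [descend, perLevel, replay_pure]
  | n + 1, X, fs, as => by
    rw [descend, replay_perLevel_succ]
    rcases replay (levelPre mk X) as with q | ⟨_ | ⟨p, v0⟩, as'⟩
    · rfl
    · rfl
    · dsimp only
      rw [descend_eq n (minorOf X p) _ as']
      rcases replay (perLevel mk g n (minorOf X p)) as' with q | ⟨PY, as''⟩
      · rfl
      · dsimp only
        simp only [ascend]

/-- **The replay of the search is the two-loop model.** [cite: AaronsonArkhipovToC2013, proof of Thm. 4.3 (pp. 176–177)] -/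
theorem replay_perLevel_eq_descend (n : ℕ) (X : Matrix (Fin n) (Fin n) ℤ) (as : List (List Bool)) :
    replay (perLevel mk g n X) as = descend mk g n X [] as := by
  rw [descend_eq]
  rcases replay (perLevel mk g n X) as with q | ⟨v, as'⟩
  · rfl
  · simp only [ascend]

/-- **The step function of the search from the two-loop model.** [cite: AaronsonArkhipovToC2013, proof of Thm. 4.3 (pp. 176–177)] -/
theorem toStep_perLevel_eq (n : ℕ) (X : Matrix (Fin n) (Fin n) ℤ) (as : List (List Bool)) :
    toStep (perLevel mk g n X) as = (descend mk g n X [] as).map id Prod.fst := by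
  rw [toStep_eq_replay, replay_perLevel_eq_descend]

end Level

/-! ### The randomised search on a decorated query -/

section Rand

variable (G : ℕ) (c q₀ : Polynomial ℕ)

/-- **The maker of the randomised search** on the decorated query `u = ⟨⟨x, r⟩, ⟨listBool as, y⟩⟩`:
the query at site `s` for the matrix `M` is the `Per²`-query `⟨⟨M, 1^k⟩, block⟩` with the coin block
of that site in sub-run `|as|` (the canonical query relabelled by `coinMap`). [cite: AaronsonArkhipovToC2013, Thm. 1.1 (p. 149) with proof (p. 178)] -/
noncomputable def randMaker (u : List Bool) : Maker := fun s M => coinMap G c q₀ (inX u) (inR u) (inI u) (canon s M)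

/-- The randomised maker, unfolded. [folklore] -/
theorem randMaker_apply (u : List Bool) (s : Site) (M : Σ n : ℕ, Fin n → Fin n → ℤ) :
    randMaker G c q₀ u s M = perSqQuery M.2 ((kp G q₀).eval (inX u).length)
      (chunk ((ellp G c q₀).eval (inX u).length)
        (inI u * (NSp G q₀).eval (inX u).length + siteIdx G q₀ (inX u).length s) (inR u)) :=
  coinMap_canon G c q₀ _ _ _ s M

/-- **The transcript step function of the randomised search from the two-loop model**: on a
decorated query whose matrix code `y` decodes to a `0/1` matrix `X` of dimension `n`, it is the
pending query of `descend` for the randomised maker, or the clamped binary answer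
`encodeNat (min v n!)`; otherwise the empty answer at once. This is the function the machine of
`randSearchAlg_isPolyTime` has to compute. [cite: AaronsonArkhipovToC2013, proof of Thm. 4.3 (pp. 176–177) with proof of Thm. 1.1 (p. 178)] -/
theorem toStep_randComp (u : List Bool) (as : List (List Bool)) :
    toStep (randComp G c q₀ u) as =
      match encodingIntMatrix.decode (inY u) with
      | none => Sum.inr []
      | some M =>
        if isZeroOneEntries M then
          match descend (randMaker G c q₀ u) G M.1 (Matrix.of M.2) [] as with
          | Sum.inl q => Sum.inl q
          | Sum.inr (v, _) => Sum.inr (encodeNat (min v M.1.factorial))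
        else Sum.inr [] := by
  unfold randComp
  cases encodingIntMatrix.decode (inY u) with
  | none => exact toStep_pure' _ _
  | some M =>
    dsimp only
    by_cases h01 : isZeroOneEntries M = true
    · rw [if_pos h01, if_pos h01, toStep_eq_replay, replay_bind, relabel_perLevel, replay_perLevel_eq_descend,
        show (fun s M' => coinMap G c q₀ (inX u) (inR u) (inI u) (canon s M')) = randMaker G c q₀ u from rfl]
      rcases descend (randMaker G c q₀ u) G M.1 (Matrix.of M.2) [] as with q | ⟨v, as'⟩
      · rfl
      · dsimp only
        rw [replay_pure]
        rfl
    · rw [if_neg h01, if_neg h01]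
      exact toStep_pure' _ _

/-- **The step function of `randSearchAlg`.** [cite: AaronsonArkhipovToC2013, proof of Thm. 4.3 (pp. 176–177) with proof of Thm. 1.1 (p. 178)] -/
theorem randSearchAlg_step (u : List Bool) (as : List (List Bool)) :
    (randSearchAlg G c q₀).step u as = toStep (randComp G c q₀ u) as := rfl

end Rand

end PerSearch

end Literature.Computability.QuantumComplexity
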